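import Literature.MathematicalPhysics.KineticTheory.HardSphereEulerContinuation
import Literature.MathematicalPhysics.KineticTheory.HardSphereEulerLocalExistence
import HarnessLib

/-!
# The continuation principle for the hard-sphere Euler system: the discharge of
# `hsEuler_continuation` (topic `MathematicalPhysics/KineticTheory`)

MathematicalPhysics/KineticTheory proof file (theorems only; no definitions, no named facts)
discharging the named fact `Literature.MathematicalPhysics.KineticTheory.hsEuler_continuation`
(`HardSphereEulerLocalTheory.lean`: Dafermos 2005, Ch. V §5.1, Thm 5.1.1, maximality clause —
a classical solution of the hard-sphere Euler system on `[0, T) × 𝕋³` whose state stays in a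
compact subset of the state domain and whose first spatial derivatives stay bounded extends to a
classical solution on `[0, T₂) × 𝕋³`, `T₂ > T`; equivalently `T_∞ < ∞` forces blow-up of the
`C¹` norm or escape from every compact subset of `𝒪`, Dafermos (5.1.4), Majda 1984 Thm 2.2 with
Cor. 1–2).

The two halves of the printed proof are in the tree:

* `hsEuler_continuation_of_hsEuler_localExistence` (`HardSphereEulerContinuation.lean`): the
  continuation principle FROM local existence — symmetrised `H^m` energy estimates giving bounds
  on all spatial derivatives from the `C¹` bound and the compact state box
  (`CompressibleEulerAprioriBounds`, Dafermos (5.1.25)–(5.1.26) / Majda (2.38)), smooth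
  extension to the closed slab, restart from `t = T` by local existence and junction of the two
  solutions along `t = T` with matching `∞`-jets (`CompressibleEulerJunction`);
* `hsEuler_localExistence_holds` (`HardSphereEulerLocalExistence.lean`): local existence itself
  (Dafermos Thm 5.1.1, existence clause; Majda Thm 2.1: Picard iteration on the linearised
  symmetric hyperbolic system, `TorusQuasilinear*`).

Main result: `hsEuler_continuation_holds`.

## References

* C. M. Dafermos, *Hyperbolic Conservation Laws in Continuum Physics*, 2nd ed., Grundlehren
  325, Springer 2005, Ch. V §5.1, Thm 5.1.1 and its proof, pp. 122–126; §5.4 Notes, p. 139.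
  [`Dafermos2005`]
* A. Majda, *Compressible Fluid Flow and Systems of Conservation Laws in Several Space
  Variables*, Springer 1984, Ch. 2 §2.1, Thms 2.1–2.2, Cor. 1–2. [`Majda1984`]
-/

noncomputable section

namespace Literature.MathematicalPhysics.KineticTheory

/-- **The continuation principle for classical solutions of the hard-sphere Euler system on
`𝕋³`** (discharge of the named fact `hsEuler_continuation`): Dafermos's Theorem 5.1.1,
maximality clause (5.1.4), for the compressible Euler system with the hard-sphere constitutive
relation — a classical solution on `[0, T)` with state in a compact box of the state domain and
bounded first spatial derivatives continues to a classical solution on `[0, T₂)`, `T₂ > T`.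
Proof: `hsEuler_continuation_of_hsEuler_localExistence` (a-priori `H^m` bounds, restart,
junction) applied to `hsEuler_localExistence_holds` (local existence).
[cite: Dafermos2005, Ch. V §5.1, Thm 5.1.1 (pp. 122–126)] -/
theorem hsEuler_continuation_holds : hsEuler_continuation :=
  hsEuler_continuation_of_hsEuler_localExistence hsEuler_localExistence_holds

end Literature.MathematicalPhysics.KineticTheory

end
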